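import Summits.ABC.ABC.Theses.CuspFieldPencil
import HarnessLib

/-!
# Number-field pencil theorem: reduction of `k ≥ 3` forms to three forms

`Summits/ABC/ABC/Theorems/CuspFieldPencilNFPencilReduction.lean` — helper toward the crux
stmt-ABC-26250 `Summit.ABC.ABC.Theses.CuspFieldPencil.NFPencilBound` (draft class-record route
`CuspFieldPencil`, LINE 17), UNCONDITIONAL bookkeeping («min-triple economy», the registered stub
`stub_fourOrMoreForms` modulo `stub_threeForms`):

`nfPencilBound_of_threeForms`: if the pencil bound holds for every THREE pairwise non-proportional
`𝓞_K`-linear forms (exponent `1/3 + ε`), then `NFPencilBound` holds for every `k ≥ 3` forms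
(exponent `1/k + ε`).

**Proof.** Given `k ≥ 3` forms and coprime `u, w` with all `Lᵢ(u,w) ≠ 0`, every
`Gᵢ = N(rad(Lᵢ𝓞_K)) ≥ 1`. Sort the `Gᵢ` (`Tuple.sort`) and take the three smallest,
`q = G_{i₁}G_{i₂}G_{i₃}`: every other `G_j ≥ max(G_{i₁}, G_{i₂}, G_{i₃})`, so `G_j³ ≥ q` and
`(∏ Gᵢ)³ ≥ q³ · q^{k−3} = q^k`, i.e. `q ≤ (∏Gᵢ)^{3/k}`. The three-forms bound for the triple
`(i₁, i₂, i₃)` (one constant `C_σ` per injection `σ : Fin 3 ↪ Fin k`; take `C = Σ_σ C_σ⁺`, finitely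
many) gives `log max(|u|,|w|) ≤ C_σ q^{1/3+ε} ≤ C (∏Gᵢ)^{(3/k)(1/3+ε)} ≤ C (∏Gᵢ)^{1/k+ε}`
(`∏Gᵢ ≥ 1`, `3ε/k ≤ ε`).

HONESTY. Unconditional bookkeeping for a CLASS RECORD at abc distance 0 (width 0); it does NOT prove
`NFPencilBound` (the three-forms case is the open content, = Scoones 2021 Thm 3 + height
comparison); NOT abc, NOT A-PS; abc moved by 0; typed ≠ proved.

References: [folklore] (AM–GM / sorting); arXiv:2111.07791 only as motivation.
-/

set_option linter.dupNamespace false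

namespace Summit.ABC.ABC.Theorems

open NumberField

namespace NFPencilReduction

/-- Sorting lemma: for `g : Fin (3 + n) → ℕ` there is an injection `σ : Fin 3 ↪ Fin (3 + n)` (the three
smallest values) with `(∏_{i<3} g(σ i))^{3+n} ≤ (∏ g)³`. [folklore] -/
theorem exists_three_smallest (n : ℕ) (g : Fin (3 + n) → ℕ) :
    ∃ σ : Fin 3 ↪ Fin (3 + n), (∏ i, g (σ i)) ^ (3 + n) ≤ (∏ i, g i) ^ 3 := by
  classical
  let e := Tuple.sort g
  have hmono : Monotone (g ∘ e) := Tuple.monotone_sort g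
  refine ⟨⟨fun i => e (Fin.castAdd n i), fun i j h => by
    simpa using e.injective h⟩, ?_⟩
  simp only [Function.Embedding.coeFn_mk]
  -- reindex the full product along the sorting permutation
  have hP : ∏ i, g i = ∏ m, (g ∘ e) m := by
    rw [← Equiv.prod_comp e g]; rfl
  set q := ∏ i : Fin 3, g (e (Fin.castAdd n i)) with hq
  have hle : ∀ j : Fin n, q ≤ ((g ∘ e) (Fin.natAdd 3 j)) ^ 3 := by
    intro j
    have h1 : ∀ i : Fin 3, g (e (Fin.castAdd n i)) ≤ (g ∘ e) (Fin.natAdd 3 j) := by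
      intro i
      apply hmono
      rw [Fin.le_def]
      simp only [Fin.val_castAdd, Fin.val_natAdd]
      omega
    rw [hq, Fin.prod_univ_three, pow_succ, pow_two]
    exact Nat.mul_le_mul (Nat.mul_le_mul (h1 0) (h1 1)) (h1 2)
  rw [hP, Fin.prod_univ_add, mul_pow, pow_add]
  have h2 : q ^ n ≤ ∏ j : Fin n, (g ∘ e) (Fin.natAdd 3 j) ^ 3 := by
    calc q ^ n = ∏ _j : Fin n, q := by simp
      _ ≤ ∏ j : Fin n, (g ∘ e) (Fin.natAdd 3 j) ^ 3 := Finset.prod_le_prod' fun j _ => hle j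
  refine Nat.mul_le_mul (le_of_eq (by rw [hq]; rfl)) ?_
  rw [Finset.prod_pow] at h2
  exact h2

/-- Real form of the sorting lemma: `q^k ≤ P^3`, `k ≥ 1` ⇒ `q ≤ P^{3/k}`. [folklore] -/
theorem le_rpow_of_pow_le {q P k : ℕ} (hk : k ≠ 0) (h : q ^ k ≤ P ^ 3) :
    (q : ℝ) ≤ (P : ℝ) ^ ((3 : ℝ) / k) := by
  have hq0 : (0 : ℝ) ≤ q := Nat.cast_nonneg _
  have hP0 : (0 : ℝ) ≤ P := Nat.cast_nonneg _
  have h' : ((q : ℝ) ^ k) ≤ (P : ℝ) ^ 3 := by exact_mod_cast h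
  have hk0 : (0 : ℝ) < k := by exact_mod_cast Nat.pos_of_ne_zero hk
  calc (q : ℝ) = (((q : ℝ) ^ k) ^ ((k : ℝ)⁻¹)) := (Real.pow_rpow_inv_natCast hq0 hk).symm
    _ ≤ ((P : ℝ) ^ 3) ^ ((k : ℝ)⁻¹) :=
        Real.rpow_le_rpow (pow_nonneg hq0 _) h' (inv_nonneg.mpr hk0.le)
    _ = (P : ℝ) ^ ((3 : ℝ) / k) := by
        rw [show ((P : ℝ) ^ 3) = (P : ℝ) ^ (3 : ℝ) by norm_cast, ← Real.rpow_mul hP0]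
        congr 1

/-- Exponent bookkeeping: for `P ≥ 1`, `k ≥ 3`, `ε ≥ 0`:
`(P^{3/k})^{1/3+ε} ≤ P^{1/k+ε}`. [folklore] -/
theorem rpow_three_div_le {P : ℝ} {k : ℕ} {ε : ℝ} (hP : 1 ≤ P) (hk : 3 ≤ k) (hε : 0 ≤ ε) :
    (P ^ ((3 : ℝ) / k)) ^ (1 / (3 : ℝ) + ε) ≤ P ^ (1 / (k : ℝ) + ε) := by
  have hP0 : 0 ≤ P := zero_le_one.trans hP
  rw [← Real.rpow_mul hP0]
  apply Real.rpow_le_rpow_of_exponent_le hP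
  have hk0 : (0 : ℝ) < k := by exact_mod_cast (show 0 < k by omega)
  have hk3 : (3 : ℝ) ≤ k := by exact_mod_cast hk
  rw [div_mul_eq_mul_div, mul_add, show (3 : ℝ) * (1 / 3) = 1 by norm_num, add_div]
  gcongr
  rw [div_le_iff₀ hk0]
  nlinarith

end NFPencilReduction

open NFPencilReduction in
/-- REDUCTION (registered stub `stub_fourOrMoreForms` modulo `stub_threeForms`, unconditional): if the
number-field pencil bound holds for every three pairwise non-proportional `𝓞_K`-linear forms over every
class-number-one number field `K` (exponent `1/3 + ε`), then `NFPencilBound` holds (all `k ≥ 3`,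
exponent `1/k + ε`) — by running the three-forms bound on the three forms with the smallest
`Gᵢ = N(rad(Lᵢ𝓞_K))`, whose product is `≤ (∏Gᵢ)^{3/k}`. [folklore] -/
theorem nfPencilBound_of_threeForms
    (h3 : ∀ (K : Type) [Field K] [NumberField K], IsPrincipalIdealRing (𝓞 K) →
      ∀ (α β : Fin 3 → 𝓞 K), (∀ i j, i ≠ j → α i * β j ≠ α j * β i) → ∀ ε : ℝ, 0 < ε →
        ∃ C : ℝ, ∀ u w : ℤ, IsCoprime u w →
          (∏ i, (α i * (u : 𝓞 K) + β i * (w : 𝓞 K))) ≠ 0 →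
            Real.log ((max |u| |w| : ℤ) : ℝ) ≤ C *
              ((∏ i, Ideal.absNorm (Ideal.span {α i * (u : 𝓞 K) + β i * (w : 𝓞 K)}).radical : ℕ) : ℝ) ^
                (1 / (3 : ℝ) + ε)) :
    Summit.ABC.ABC.Theses.CuspFieldPencil.NFPencilBound := by
  intro K _ _ hPID k α β hk hprop ε hε
  classical
  obtain ⟨n, rfl⟩ : ∃ n, k = 3 + n := ⟨k - 3, by omega⟩
  -- one constant per injection `σ : Fin 3 ↪ Fin (3 + n)`
  have hC : ∀ σ : Fin 3 ↪ Fin (3 + n), ∃ C : ℝ, ∀ u w : ℤ, IsCoprime u w →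
      (∏ i, (α (σ i) * (u : 𝓞 K) + β (σ i) * (w : 𝓞 K))) ≠ 0 →
        Real.log ((max |u| |w| : ℤ) : ℝ) ≤ C *
          ((∏ i, Ideal.absNorm (Ideal.span {α (σ i) * (u : 𝓞 K) + β (σ i) * (w : 𝓞 K)}).radical :
            ℕ) : ℝ) ^ (1 / (3 : ℝ) + ε) :=
    fun σ => h3 K hPID (α ∘ σ) (β ∘ σ) (fun i j hij => hprop (σ i) (σ j)
      (fun h => hij (σ.injective h))) ε hε
  choose C hC using hC
  refine ⟨∑ σ, max (C σ) 0, ?_⟩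
  intro u w hcop hne
  -- notation-free abbreviations
  set L : Fin (3 + n) → 𝓞 K := fun i => α i * (u : 𝓞 K) + β i * (w : 𝓞 K) with hL
  set g : Fin (3 + n) → ℕ := fun i => Ideal.absNorm (Ideal.span {L i}).radical with hg
  have hLi : ∀ i, L i ≠ 0 := fun i hi => hne (Finset.prod_eq_zero (Finset.mem_univ i) hi)
  have hgi : ∀ i, g i ≠ 0 := by
    intro i
    simp only [hg, Ne, Ideal.absNorm_eq_zero_iff]
    intro h
    have : Ideal.span {L i} = ⊥ := le_bot_iff.mp (Ideal.le_radical.trans h.le)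
    exact hLi i (Ideal.span_singleton_eq_bot.mp this)
  have hPpos : 0 < ∏ i, g i := Finset.prod_pos fun i _ => Nat.pos_of_ne_zero (hgi i)
  have hP1 : (1 : ℝ) ≤ ((∏ i, g i : ℕ) : ℝ) := by exact_mod_cast hPpos
  -- the three smallest
  obtain ⟨σ, hσ⟩ := exists_three_smallest n g
  have hne3 : (∏ i, (α (σ i) * (u : 𝓞 K) + β (σ i) * (w : 𝓞 K))) ≠ 0 :=
    Finset.prod_ne_zero_iff.mpr fun i _ => hLi (σ i)
  have hmain := hC σ u w hcop hne3
  have hq : ((∏ i, Ideal.absNorm (Ideal.span {α (σ i) * (u : 𝓞 K) + β (σ i) * (w : 𝓞 K)}).radical :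
      ℕ) : ℝ) ≤ ((∏ i, g i : ℕ) : ℝ) ^ ((3 : ℝ) / (3 + n : ℕ)) :=
    le_rpow_of_pow_le (by omega) hσ
  have he0 : 0 ≤ 1 / (3 : ℝ) + ε := by positivity
  have hq0 : (0 : ℝ) ≤ ((∏ i, Ideal.absNorm (Ideal.span {α (σ i) * (u : 𝓞 K) +
      β (σ i) * (w : 𝓞 K)}).radical : ℕ) : ℝ) := Nat.cast_nonneg _
  have hCσ : C σ ≤ ∑ τ, max (C τ) 0 :=
    (le_max_left _ _).trans (Finset.single_le_sum (fun τ _ => le_max_right _ _) (Finset.mem_univ σ))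
  have hsum0 : 0 ≤ ∑ τ, max (C τ) 0 := Finset.sum_nonneg fun τ _ => le_max_right _ _
  calc Real.log ((max |u| |w| : ℤ) : ℝ)
      ≤ C σ * ((∏ i, Ideal.absNorm (Ideal.span {α (σ i) * (u : 𝓞 K) + β (σ i) * (w : 𝓞 K)}).radical :
          ℕ) : ℝ) ^ (1 / (3 : ℝ) + ε) := hmain
    _ ≤ (∑ τ, max (C τ) 0) * ((∏ i, Ideal.absNorm (Ideal.span {α (σ i) * (u : 𝓞 K) +
          β (σ i) * (w : 𝓞 K)}).radical : ℕ) : ℝ) ^ (1 / (3 : ℝ) + ε) :=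
        mul_le_mul_of_nonneg_right hCσ (Real.rpow_nonneg hq0 _)
    _ ≤ (∑ τ, max (C τ) 0) * ((((∏ i, g i : ℕ) : ℝ) ^ ((3 : ℝ) / (3 + n : ℕ))) ^ (1 / (3 : ℝ) + ε)) :=
        mul_le_mul_of_nonneg_left (Real.rpow_le_rpow hq0 hq he0) hsum0
    _ ≤ (∑ τ, max (C τ) 0) * ((∏ i, g i : ℕ) : ℝ) ^ (1 / ((3 + n : ℕ) : ℝ) + ε) :=
        mul_le_mul_of_nonneg_left (rpow_three_div_le hP1 (by omega) hε.le) hsum0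

end Summit.ABC.ABC.Theorems
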